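import Literature.NumberTheory.Automorphic.QuadraticLocalNormResidueBridge
import Literature.NumberTheory.QuadraticForms.HilbertSymbolAtUnramifiedPlace
import Literature.NumberTheory.NumberFields.CMFieldTotallyNegativeGenerator
import HarnessLib

/-!
# A `(σ ⊗ 1)`-fixed unit of `E ⊗_F F_v = ∏_{w ∣ v} E_w` is `z · (σ ⊗ 1) z` for a unit `z` at every place `v` UNRAMIFIED in the
# quadratic extension `E ∕ F` — units are local norms at unramified places (O'Meara 63:16), in the currency of the `κ_v`-test

Topic `NumberTheory/Automorphic`; namespace `Literature.NumberTheory.Automorphic.UnitaryGroup` (home of ★ `LocalRing E v`, ★ `conjLocal`,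
★ `toLocalRing`, ★ `quadraticLocalEquiv`, ★ `QuadraticLocalNormResidueBridge`).  THEOREMS ONLY (no definition, no named fact, no instance, no
notation, no `sorry`; net debt 0).  Cell `pub/hodgecm-mathlib`, F0∕P3a, topic T6 (#72 pay-down), desk TABLE #3 row (4) N3 «`Δ‴_v = 1` for almost
all `v`» (A-p16 (g22)), sub-node (κ2) handed to F0P3a-p01 (g7) 16:09Z: the bridge «unit ⇒ unit norm» that A-p16's FILE C plugs into ★
`finKappaAt_eq_one_of_eigenvector_of_exists` (★ `FinExplicitTransferFactorKappaEigenvector`, p827970) after its FILE B (★ `RankOneHermitianColumnNorm`,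
p827910) has produced, at an unramified non-split `v`, the `H′_v`-value of an integral `u`-eigenvector as a `(σ ⊗ 1)`-fixed element with unit
coordinates.  HONEST LABEL: HC_CM is proved only modulo the printed citations (named inputs remaining 2) until rung 0 closes; this file is local
algebra of quadratic extensions and proves none of them.

THE MATHEMATICS.  `E ∕ F` quadratic, `σ ∈ Aut(E∕F)` with `σ δ = −δ ≠ 0`, `δ² = d ∈ F`; `v` a finite place of `F`; `E ⊗_F F_v = F_v ⊕ F_v δ`
(★ `quadraticLocalEquiv`) with `(σ ⊗ 1)(ι_v a + ι_v b·δ) = ι_v a − ι_v b·δ` (★ `conjLocal_quadraticLocalEquiv`).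
* §1 `exists_eq_toLocalRing_of_conjLocal_eq` — a `(σ ⊗ 1)`-FIXED element is `ι_v a` for a (unique) `a ∈ F_v` (`b = −b` in characteristic `0`);
  `valued_eq_one_of_valued_toPlace_eq_one` — `|ι_w a|_w = 1 ⇒ |a|_v = 1` (★ `valued_toPlace`: `|ι_w a|_w = |a|_v^{e(w∣v)}`, `e ≠ 0`).
* §2 `exists_isUnit_eq_mul_conjLocal_of_conjLocal_eq_of_isUnramifiedIn` (parametric in `σ, δ, d`): at `v` UNRAMIFIED in `E`, a `(σ ⊗ 1)`-fixed `x`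
  with `|x_w|_w = 1` at every `w ∣ v` is `z·(σ ⊗ 1)z` with `z` a unit — `x = ι_v a`, `|a|_v = 1`, `(a, d)_v = 1` (★
  `hilbertSymbol_eq_one_of_valued_eq_one_of_isUnramifiedIn`, O'Meara Example 63:16: units are norms at an unramified place, dyadic places INCLUDED),
  and `(a, d)_v = 1 ⟺ ι_v a = z·(σ⊗1)z` for a unit `z` (★ `exists_isUnit_toLocalRing_eq_mul_conjLocal_iff`, O'Meara §65A).  No «non-split» and no
  «`v ∤ 2`» hypothesis.
* §3 the CM specialisation `F = L⁺`, `E = L`, `σ` = complex conjugation (★ `UnitaryGroup.conjLocal L (IsCMField.complexConj L) v`, the currency of ★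
  `finKappaAt`): **`exists_isUnit_eq_mul_conjLocal_complexConj_of_isUnramifiedIn`** — the socket A-p16's FILE C consumes (a purely imaginary `δ ≠ 0` of
  `L` exists, ★ `IsCMField.exists_complexConj_ne`; `δ² ∈ L⁺`, ★ `sq_mem_maximalRealSubfield_of_complexConj_eq_neg`).

## References
* [Omeara1963] O. T. O'Meara, *Introduction to Quadratic Forms* (1963), §63C Example 63:16 (`N_{E∕F} Ė ⊇` units at an unramified `𝔭`), §65A (local
  norms and the Hilbert symbol).
* [CasselsFrohlichANT1967] J. W. S. Cassels, A. Fröhlich (eds.), *Algebraic Number Theory* (1967), Ch. II §§10–11 (`E ⊗_F F_v ≅ ∏_{w∣v} E_w`; the fixed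
  points of `σ ⊗ 1` are `F_v`).
* [Rogawski1990] J. D. Rogawski, *Automorphic Representations of Unitary Groups in Three Variables* (1990), §14.6 p. 242 («`κ(γ, ψ_v(i(γ)))` … is `+1` for
  almost all `v`»), §4.3 p. 44.
-/

set_option autoImplicit false

noncomputable section

open NumberField IsDedekindDomain
open Literature.NumberTheory.QuadraticForms

namespace Literature.NumberTheory.Automorphic.UnitaryGroup

/-! ## §1 Fixed points of `σ ⊗ 1` and unit coordinates -/

section Fixed

variable {F : Type} (E : Type) [Field F] [NumberField F] [Field E] [NumberField E] [Algebra F E]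
variable (σ : E ≃ₐ[F] E) {δ : E} (hσδ : σ δ = -δ) (hδ : δ ≠ 0)

include hσδ hδ in
/-- **The fixed points of `σ ⊗ 1` on `E ⊗_F F_v` are `ι_v(F_v)`**: if `(σ ⊗ 1) x = x` then `x = ι_v a` for some `a ∈ F_v` (write `x = ι_v a + ι_v b·δ`,
★ `quadraticLocalEquiv`; then `(σ ⊗ 1) x = ι_v a − ι_v b·δ`, so `b = −b`, `b = 0`). [cite: CasselsFrohlichANT1967, Ch. II §10–§11] -/
theorem exists_eq_toLocalRing_of_conjLocal_eq [Algebra.IsQuadraticExtension F E] (v : HeightOneSpectrum (𝓞 F)) {x : LocalRing E v}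
    (hfix : conjLocal E σ v x = x) : ∃ a : v.adicCompletion F, x = toLocalRing E v a := by
  haveI : CharZero (v.adicCompletion F) := charZero_of_injective_algebraMap (algebraMap F (v.adicCompletion F)).injective
  obtain ⟨⟨a, b⟩, rfl⟩ := (quadraticLocalEquiv E v σ hσδ hδ).surjective x
  have hconj := conjLocal_quadraticLocalEquiv E v σ hσδ hδ a b
  rw [hfix] at hconj
  have hpair : ((a, b) : v.adicCompletion F × v.adicCompletion F) = (a, -b) := (quadraticLocalEquiv E v σ hσδ hδ).injective hconj
  have hb : b = -b := congrArg Prod.snd hpair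
  have hb0 : b = 0 := by
    have h2 : b + b = 0 := by
      nth_rewrite 2 [hb]
      exact add_neg_cancel b
    exact add_self_eq_zero.1 h2
  refine ⟨a, ?_⟩
  rw [quadraticLocalEquiv_apply]
  dsimp only
  rw [hb0, map_zero, zero_mul, add_zero]

/-- **`|ι_w a|_w = 1 ⇒ |a|_v = 1`** for `w ∣ v` (`|ι_w a|_w = |a|_v^{e(w∣v)}` with `e(w∣v) ≠ 0`, ★ `valued_toPlace`). [cite: CasselsFrohlichANT1967, Ch. II §10] -/
theorem valued_eq_one_of_valued_toPlace_eq_one (v : HeightOneSpectrum (𝓞 F)) (w : PlacesOver E v) {a : v.adicCompletion F}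
    (ha : Valued.v (toPlace v w a) = 1) : Valued.v a = 1 := by
  haveI := PlacesOver.liesOver w
  rw [valued_toPlace] at ha
  exact (pow_eq_one_iff.1 ha).resolve_right (Ideal.IsDedekindDomain.ramificationIdx'_ne_zero_of_liesOver w.1.asIdeal v.ne_bot)

end Fixed

/-! ## §2 Units are unit norms at an unramified place (parametric in `σ, δ, d`) -/

section Unramified

variable {F : Type} (E : Type) [Field F] [NumberField F] [Field E] [NumberField E] [Algebra F E]
variable (σ : E ≃ₐ[F] E) {δ : E} (hσδ : σ δ = -δ) (hδ : δ ≠ 0) {d : F} (hd : δ * δ = algebraMap F E d)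

include hσδ hδ hd in
/-- **A `(σ ⊗ 1)`-fixed element of `∏_{w ∣ v} E_w` with unit coordinates is `z · (σ ⊗ 1) z` for a unit `z`, at every finite place `v` of `F` UNRAMIFIED in
`E`** (no restriction to non-split or non-dyadic `v`): `x = ι_v a` with `|a|_v = 1` (§1), `(a, d)_v = 1` because units are local norms at an unramified place
(O'Meara Example 63:16, ★ `hilbertSymbol_eq_one_of_valued_eq_one_of_isUnramifiedIn`), and `(a, d)_v = 1` iff `ι_v a = z·(σ ⊗ 1)z` for a unit `z` (★
`exists_isUnit_toLocalRing_eq_mul_conjLocal_iff`). [cite: Omeara1963, §63C Example 63:16 with §65A] [cite: Rogawski1990, §14.6 p. 242] -/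
theorem exists_isUnit_eq_mul_conjLocal_of_conjLocal_eq_of_isUnramifiedIn [Algebra.IsQuadraticExtension F E] (v : HeightOneSpectrum (𝓞 F))
    (hunr : Algebra.IsUnramifiedIn (𝓞 E) v.asIdeal) {x : LocalRing E v} (hfix : conjLocal E σ v x = x) (hunit : ∀ w : PlacesOver E v, Valued.v (x w) = 1) :
    ∃ z : LocalRing E v, IsUnit z ∧ x = z * conjLocal E σ v z := by
  obtain ⟨a, rfl⟩ := exists_eq_toLocalRing_of_conjLocal_eq E σ hσδ hδ v hfix
  obtain ⟨w⟩ : Nonempty (PlacesOver E v) := inferInstance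
  have ha1 : Valued.v a = 1 := valued_eq_one_of_valued_toPlace_eq_one E v w (by simpa only [toLocalRing_apply] using hunit w)
  have ha0 : a ≠ 0 := fun h0 => by
    rw [h0, map_zero] at ha1
    exact zero_ne_one ha1
  have hα : δ ^ 2 = algebraMap F E d := by rw [sq, hd]
  have hαF : ∀ r : F, algebraMap F E r ≠ δ := fun r hr =>
    not_mem_range_algebraMap_of_apply_eq_neg E σ hσδ hδ ⟨r, hr⟩
  have hsymb : hilbertSymbol (v.adicCompletion F) a (algebraMap F (v.adicCompletion F) d) = 1 :=
    hilbertSymbol_eq_one_of_valued_eq_one_of_isUnramifiedIn F v hα hαF hunr ha1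
  exact (exists_isUnit_toLocalRing_eq_mul_conjLocal_iff E σ hσδ hδ hd v ha0).2 hsymb

end Unramified

/-! ## §3 The CM specialisation: the socket of ★ `finKappaAt` -/

section CM

variable (L : Type) [Field L] [NumberField L] [IsCMField L]

/-- **(κ2) FOR A CM FIELD `L ∕ L⁺`**: at a finite place `v` of `L⁺` UNRAMIFIED in `L`, every `x ∈ L ⊗_{L⁺} L⁺_v = ∏_{w ∣ v} L_w` fixed by `c ⊗ 1` (★
`UnitaryGroup.conjLocal L (IsCMField.complexConj L) v`) with `|x_w|_w = 1` at every `w ∣ v` is `z · (c ⊗ 1) z` for a unit `z` — so the norm test of Rogawski's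
`κ_v` (★ `finKappaAt`; ★ `finKappaAt_eq_one_of_eigenvector_of_exists`) PASSES on such an `x` («`κ(γ, ψ_v(i(γ)))` … is `+1` for almost all `v`»).
[cite: Omeara1963, §63C Example 63:16 with §65A] [cite: Rogawski1990, §14.6 p. 242; §4.3 p. 44] -/
theorem exists_isUnit_eq_mul_conjLocal_complexConj_of_isUnramifiedIn (v : HeightOneSpectrum (𝓞 ↥(maximalRealSubfield L)))
    (hunr : Algebra.IsUnramifiedIn (𝓞 L) v.asIdeal) {x : LocalRing L v} (hfix : conjLocal L (IsCMField.complexConj L) v x = x)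
    (hunit : ∀ w : PlacesOver L v, Valued.v (x w) = 1) :
    ∃ z : LocalRing L v, IsUnit z ∧ x = z * conjLocal L (IsCMField.complexConj L) v z := by
  obtain ⟨x₀, hx₀⟩ := Literature.NumberTheory.NumberFields.IsCMField.exists_complexConj_ne L
  set δ : L := x₀ - IsCMField.complexConj L x₀ with hδdef
  have hσδ : IsCMField.complexConj L δ = -δ := by
    rw [hδdef, map_sub, IsCMField.complexConj_apply_apply, neg_sub]
  have hδ : δ ≠ 0 := fun h => hx₀ (sub_eq_zero.1 h).symm
  set d : ↥(maximalRealSubfield L) :=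
    ⟨δ ^ 2, Literature.NumberTheory.NumberFields.sq_mem_maximalRealSubfield_of_complexConj_eq_neg hσδ⟩ with hddef
  have hd : δ * δ = algebraMap (↥(maximalRealSubfield L)) L d := by rw [← sq]; rfl
  exact exists_isUnit_eq_mul_conjLocal_of_conjLocal_eq_of_isUnramifiedIn L (IsCMField.complexConj L) hσδ hδ hd v hunr hfix hunit

end CM

end Literature.NumberTheory.Automorphic.UnitaryGroup

end
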